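import Summits.BirchSwinnertonDyer.Rank1Residual.X11a.InvariantsEndpoint
import Summits.BirchSwinnertonDyer.Rank1Residual.X11a.MainConjectureCertificates
import Literature.NumberTheory.EllipticCurves.EmertonPollackWeston2006.HidaFamilyTransfer
import HarnessLib

/-!
# Class X11a, surjective leaf: the μ-part and the λ-part of Mazur's main conjecture at a
# multiplicative prime, and the per-pair certificate `μ^an(E,p) = 0`
# (cell `b2b-bsdres`, unit `b2b-bsdres-x11a`, gen 14)

HONEST FRAMING (run/shared/lean/b2b/bsd-rank1-residual/, verbatim in every file): the goal of the
cell is to DELETE the COMBINATION-SHAPED residual classes of the Birch–Swinnerton-Dyer formula for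
ALL analytic-rank `≤ 1` elliptic curves over `ℚ` — "full BSD formula for every rank `≤ 1` curve in
class `C`" assembled STRICTLY from published theorems — so that the rank-`≤ 1` remainder becomes
exactly the CONSTRUCTION-SHAPED classes, which are TYPED (missing-input `Prop`s), NOT attempted.
This is not "finishing BSD". Research route; NO CLAIM BEYOND STATED CLASSES. Four definitions
(typed inputs / a certificate shape, nothing asserted) and theorems; no named fact.

**Setting.** `E/ℚ` (globally minimal `W`), a prime `p ≥ 5` with `p ‖ N`, `ρ̄_{E,p}` surjective,
`ord_{s=1} L(E,s) = 0`: X11a's SURJECTIVE LEAF (`X11a/Cells.lean`, `X11a/LeafMainConjecture.lean`),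
where `BSD(E,p)` ⟺ Mazur's main conjecture at the pair (`X11a.mazurMainConjectureAt_iff_bsdp`)
⟺ the Emerton–Pollack–Weston-shaped invariants statement `X11a.InvariantsMatchAt W p`
(`X11a/InvariantsEndpoint.lean`, gen 13). Write `char_Λ X(E/ℚ_∞) = (f_E)` and let `g ∈ Λ` be the
integral element with `ι(T^e · g) = ϖ · L_p` (`e = 1` split, `0` non-split; it exists and lies in
`(f_E)` by Kato's divisibility for surjective image, tree fact
`Wuthrich2014.kato_charIdeal_dvd_multiplicative_of_surjective`, PUB, flag `Wu14-surj-attribution`).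
In Greenberg–Vatsal's words (Invent. Math. 142 (2000) p. 4): "the equality `λ_alg = λ_an` implies
that `f_alg` and `f_an` differ by multiplication by a power of `p`. The further equality
`μ_alg = μ_an` then implies the Main [statement]". This file, the X11a twin of eisenstein-p1's
`X1/MuLambda.lean` (good ordinary, reducible), puts that split IN THE KERNEL at `p ‖ N` and adds the
per-pair certificate:

* `InvariantsAt W p P` — the common quantifier prefix of the cell's statements at a multiplicative
  prime: for all cyclotomic data `(κ, γ)`, every newform `f` of `W`, every dual datum `D`, every `ϖ`
  with `ϖ·Ω_E = Ω⁺_f`, every generator `fE` of `char_Λ X` and every `g ∈ Λ` with `ι(T^e g) = ϖ·L_p`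
  (THE Mazur–Tate–Teitelbaum function): `P g fE`. `InvariantsMatchAt W p` IS
  `InvariantsAt W p (μ g = μ fE ∧ λ g = λ fE)` (`invariantsMatchAt_iff`, `Iff.rfl`).
* `MuPartAt W p := InvariantsAt W p (μ g ≤ μ fE)` ("`μ_an ≤ μ_alg`"), `LambdaPartAt W p :=
  InvariantsAt W p (λ g ≤ λ fE)` ("`λ_an ≤ λ_alg`"; the reverse inequalities are Kato's theorem).
* `MuAnZeroAt W p` — THE PER-PAIR CERTIFICATE "`μ^an(E,p) = 0`" in the shape the Iwasawa lanes
  compute it (and in the shape of the binder `hμ` of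
  `EmertonPollackWeston2006.multiplicativeCharIdealMuZero_of_thmA`): for every newform `f` of `W` and
  `ϖ` with `ϖ·Ω_E = Ω⁺_f`, SOME coefficient of `ϖ·L_p` (the Néron-normalised Mazur–Tate–Teitelbaum
  series) is a `p`-adic unit. A `Prop`; nothing asserted (Greenberg's `μ = 0` conjecture territory at
  class level; a finite modular-symbol computation per pair).

Theorems (all compositions of tree facts/theorems; hypotheses named as in gen 13):
* `invariantsAt_dvd_of_kato` (Kato, `p ≥ 5`, surj): `InvariantsAt W p (fE ∣ g)`;
  `invariantsAt_ne_zero` (`r_an = 0`, Greenberg–Stevens, `𝓛_p ≠ 0`, modularity): `InvariantsAt W p (g ≠ 0)`.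
* `invariantsAt_hasUnitContent_of_muAnZeroAt`: the certificate gives `μ(g) = 0` (unconditionally), so
  `muPartAt_of_muAnZeroAt`; and WITH Kato `invariantsAt_hasUnitContent_generator_of_muAnZeroAt`:
  **`μ(f_E) = 0`, i.e. `μ^alg(E,p) = 0` — `μ(X(E/ℚ_∞)) = 0` — from the certificate and the
  published divisibility** (step [L4] of HOME/b2b-bsdres-x11a/X11A-CHAIN.md, audited PASS by the
  literature seat, HOME/b2b-bsdres-lit/g14/X11A-AUDIT.md).
* Companion file `X11a/LambdaEndpoint.lean` (theorems only): MC ⟺ μ-part ∧ λ-part on the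
  surjective leaf, and WITH THE CERTIFICATE `BSD(E,p)` ⟺ the λ-part `λ_an(E,p) ≤ λ_alg(E,p)` — the
  located gap in the currency of Emerton–Pollack–Weston's Thm. 2 / Thm. 5.1.3 (the λ-defect is what
  their Hida-family transfer moves; the candidate published supplier, X. Wan, Forum Math. Sigma 3
  (2015) Thm. 4 = Thm. 103 at a good-ordinary HIGHER-WEIGHT member of `H(E[p])`, is NOT typed: the
  tree has no Selmer / characteristic-ideal vocabulary for weight-`k` newforms over `ℚ_∞` and no
  canonical period; see HOME/b2b-bsdres-x11a/GL2-VOCAB-SPEC.md).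

What this does NOT do: no label change (X11a stays COMBINATION-SHAPED; class level open); the
λ-part is typed, not supplied; nothing for the non-surjective leaf or `p = 3`.

References: [GreenbergVatsal2000] (1)–(2), p. 4; [EmertonPollackWeston2006] Thm. 1, Thm. 2,
Thm. 5.1.2, Thm. 5.1.3, Def. 4.4.1; [Wuthrich2014] Thm. 3, Cor. 19; [GreenbergLNM1716] Conj. 1.11,
§4 pp. 112–113, p. 180; [Washington1997] §7.1; [MazurTateTeitelbaum1986] §I.14–15;
HOME/b2b-bsdres-x11a/X11A-CHAIN.md, HOME/b2b-bsdres-lit/g14/X11A-AUDIT.md.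
-/

set_option autoImplicit false

noncomputable section

open scoped Classical MatrixGroups ModularForm

open CongruenceSubgroup WeierstrassCurve Literature.NumberTheory.EllipticCurves
  Literature.NumberTheory.EllipticCurves.ModularForms
  Literature.NumberTheory.EllipticCurves.Rank1Residual
  Literature.NumberTheory.EllipticCurves.Rank1Residual.Typed
  Literature.NumberTheory.EllipticCurves.Wuthrich2014
  Literature.NumberTheory.EllipticCurves.SteinWuthrich2013
  Literature.NumberTheory.EllipticCurves.GreenbergVatsal2000
  Literature.NumberTheory.EllipticCurves.EmertonPollackWeston2006
  Summit.BirchSwinnertonDyer.Rank1Residual.X1.MuLambda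

namespace Summit.BirchSwinnertonDyer.Rank1Residual.X11a

/-! ### `μ = 0` in `Λ = ℤ_p⟦T⟧` versus unit content -/

section Algebra

variable {p : ℕ} [Fact p.Prime]

/-- A power series over `ℤ_p` with a unit coefficient is non-zero. [folklore] -/
theorem ne_zero_of_hasUnitContent {g : IwasawaAlgebra p} (h : HasUnitContent g) : g ≠ 0 := by
  rintro rfl
  obtain ⟨n, hn⟩ := h
  rw [map_zero] at hn
  exact not_isUnit_zero hn

/-- `μ(g) = 0` for a power series of unit content (Greenberg–Vatsal (2): `p^μ` is the exact power of
`p` dividing `g`; eisenstein-p1's `X1.MuLambda.mu`). [cite: GreenbergVatsal2000, p. 2, (2)] -/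
theorem mu_eq_zero_of_hasUnitContent {g : IwasawaAlgebra p} (h : HasUnitContent g) : mu g = 0 := by
  have hg : g ≠ 0 := ne_zero_of_hasUnitContent h
  have hnd : ¬ PowerSeries.C (p : ℤ_[p]) ∣ g := (hasUnitContent_iff_not_C_dvd g).mp h
  by_contra hμ
  apply hnd
  have hdvd := C_pow_mu_dvd hg
  obtain ⟨k, hk⟩ : ∃ k, mu g = k + 1 := Nat.exists_eq_add_one_of_ne_zero hμ
  rw [hk, pow_succ, map_mul] at hdvd
  exact dvd_trans (Dvd.intro_left _ rfl) hdvd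

/-- Conversely a non-zero `g ∈ Λ` with `μ(g) = 0` has unit content. [cite: GreenbergVatsal2000, p. 2, (2)] -/
theorem hasUnitContent_of_mu_eq_zero {g : IwasawaAlgebra p} (hg : g ≠ 0) (h : mu g = 0) :
    HasUnitContent g := by
  rw [hasUnitContent_iff_not_C_dvd]
  intro hdvd
  have h1 : 1 ≤ mu g := le_mu_of_C_pow_dvd hg (n := 1) (by rwa [pow_one])
  omega

/-- For `g ≠ 0`: `μ(g) = 0 ↔` unit content. [cite: GreenbergVatsal2000, p. 2, (2)] -/
theorem mu_eq_zero_iff_hasUnitContent {g : IwasawaAlgebra p} (hg : g ≠ 0) :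
    mu g = 0 ↔ HasUnitContent g :=
  ⟨hasUnitContent_of_mu_eq_zero hg, mu_eq_zero_of_hasUnitContent⟩

/-- Unit content of a product forces unit content of each factor (`p ∣ a ⇒ p ∣ a·b`). [folklore] -/
theorem hasUnitContent_left_of_mul {a b : IwasawaAlgebra p} (h : HasUnitContent (a * b)) :
    HasUnitContent a := by
  rw [hasUnitContent_iff_not_C_dvd] at h ⊢
  exact fun hd => h (dvd_mul_of_dvd_left hd b)

end Algebra

/-! ### The common quantifier prefix and the typed parts -/

section Typed

/-- **The invariants relation `P` at the pair `(E, p)`, `p ‖ N`** (quantifier prefix shared with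
`X11a.InvariantsMatchAt` and `X2.MazurMainConjectureAt`; nothing asserted): for the cyclotomic data
`(κ, γ)`, every newform `f` of `W`, every dual datum `D` of `Sel_{p^∞}(E/ℚ_∞)`, every `ϖ ∈ ℚ` with
`ϖ·Ω_E = Ω⁺_f`, every generator `fE` of `char_Λ X` and every `g ∈ Λ` with `ι(g) = ϖ·L` for THE
non-split Mazur–Tate–Teitelbaum function (non-split `p`), resp. `ι(T·g) = ϖ·L` for THE split one
(split `p`): `P g fE`. With `P = (μ g = μ fE ∧ λ g = λ fE)` this is `InvariantsMatchAt`
(Emerton–Pollack–Weston's "`μ^alg = μ^an`, `λ^alg = λ^an`" at `f_E`).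
[cite: EmertonPollackWeston2006, §5.1 and Thm. 5.1.3 (shape only; nothing asserted)]
[cite: GreenbergVatsal2000, (1)–(2) and p. 4 (shape only; nothing asserted)] -/
def InvariantsAt (W : WeierstrassCurve ℚ) [W.IsElliptic] [W.IsGloballyMinimal] (p : ℕ) [Fact p.Prime]
    (P : IwasawaAlgebra p → IwasawaAlgebra p → Prop) : Prop :=
  ∀ (κ : ZpExtension ℚ p) (γ : Field.absoluteGaloisGroup ℚ),
      κ.IsCyclotomic → κ.IsTopGenerator γ → IsCyclotomicVariable p γ →
    ∀ {N : ℕ} [NeZero N] (f : CuspForm (Gamma0 N) 2), IsNewformOf W f →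
    ∀ (D : W.SelmerDualData κ γ) (ϖ : ℚ), (ϖ : ℝ) * W.realPeriodRat = plusPeriod f →
    ∀ (fE g : IwasawaAlgebra p), D.charIdeal = Ideal.span {fE} →
      (¬ W.HasSplitMultiplicativeReductionAtPrime p →
        ∀ L : PowerSeries ℚ_[p], IsMultPAdicLFunctionOf f p (-1) L →
          iwasawaToPowerSeries p g = PowerSeries.C ((ϖ : ℚ) : ℚ_[p]) * L → P g fE) ∧
      (W.HasSplitMultiplicativeReductionAtPrime p →
        ∀ L : PowerSeries ℚ_[p], IsSplitMultPAdicLFunctionOf f p L →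
          iwasawaToPowerSeries p (PowerSeries.X * g) = PowerSeries.C ((ϖ : ℚ) : ℚ_[p]) * L →
            P g fE)

/-- **μ-PART of Mazur's main conjecture at `(E, p)`, `p ‖ N` (TYPED; nothing asserted):**
`μ(g) ≤ μ(fE)` for every Kato pair — "`μ_an ≤ μ_alg`" in Greenberg–Vatsal's notation (the reverse
inequality is Kato's theorem for surjective image). Supplied per pair by the certificate
`MuAnZeroAt` (`muPartAt_of_muAnZeroAt`). [cite: GreenbergVatsal2000, (1)–(2) and p. 4 (shape only; nothing asserted)] -/
def MuPartAt (W : WeierstrassCurve ℚ) [W.IsElliptic] [W.IsGloballyMinimal] (p : ℕ) [Fact p.Prime] :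
    Prop :=
  InvariantsAt W p fun g fE => mu g ≤ mu fE

/-- **λ-PART of Mazur's main conjecture at `(E, p)`, `p ‖ N` (TYPED; nothing asserted):**
`λ(g) ≤ λ(fE)` for every Kato pair — "`λ_an ≤ λ_alg`" (the reverse is Kato's theorem). This is the
typed missing input of X11a's surjective leaf at a pair carrying the certificate `μ^an(E,p) = 0`
(`bsdp_iff_lambdaPart_of_muAnZeroAt`); the quantity `λ^alg − λ^an` is what Emerton–Pollack–Weston's
Thm. 2 / Thm. 5.1.3 transport along the Hida family `H(E[p])`.
[cite: GreenbergVatsal2000, (1)–(2) and p. 4 (shape only; nothing asserted)]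
[cite: EmertonPollackWeston2006, Thm. 2 and Thm. 5.1.3 (shape only; nothing asserted)] -/
def LambdaPartAt (W : WeierstrassCurve ℚ) [W.IsElliptic] [W.IsGloballyMinimal] (p : ℕ)
    [Fact p.Prime] : Prop :=
  InvariantsAt W p fun g fE => lam g ≤ lam fE

/-- **The per-pair certificate `μ^an(E,p) = 0` at a multiplicative prime** (a `Prop`; nothing
asserted; a finite modular-symbol computation per pair, Greenberg's `μ`-conjecture at class level):
for every newform `f` of `W` and every `ϖ ∈ ℚ` with `ϖ·Ω_E = Ω⁺_f`, some coefficient of the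
Néron-normalised Mazur–Tate–Teitelbaum series `ϖ·L_p` — THE non-split function
(`IsMultPAdicLFunctionOf f p (-1)`) at a non-split `p`, THE split one (`IsSplitMultPAdicLFunctionOf`)
at a split `p` — is a `p`-adic unit. Same shape as the binder `hμ` of
`EmertonPollackWeston2006.multiplicativeCharIdealMuZero_of_thmA`.
[cite: GreenbergVatsal2000, p. 2–3, (2) and "μ_anal" (shape only; nothing asserted)]
[cite: GreenbergLNM1716, Conj. 1.11 (shape only; nothing asserted)] -/
def MuAnZeroAt (W : WeierstrassCurve ℚ) [W.IsElliptic] [W.IsGloballyMinimal] (p : ℕ) [Fact p.Prime] :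
    Prop :=
  ∀ {N : ℕ} [NeZero N] (f : CuspForm (Gamma0 N) 2), IsNewformOf W f →
    ∀ (ϖ : ℚ), (ϖ : ℝ) * W.realPeriodRat = plusPeriod f →
      (¬ W.HasSplitMultiplicativeReductionAtPrime p →
        ∀ L : PowerSeries ℚ_[p], IsMultPAdicLFunctionOf f p (-1) L →
          ∃ n : ℕ, ‖PowerSeries.coeff n (PowerSeries.C ((ϖ : ℚ) : ℚ_[p]) * L)‖ = 1) ∧
      (W.HasSplitMultiplicativeReductionAtPrime p →
        ∀ L : PowerSeries ℚ_[p], IsSplitMultPAdicLFunctionOf f p L →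
          ∃ n : ℕ, ‖PowerSeries.coeff n (PowerSeries.C ((ϖ : ℚ) : ℚ_[p]) * L)‖ = 1)

end Typed

/-! ### Bookkeeping for `InvariantsAt` -/

section Combinators

variable {W : WeierstrassCurve ℚ} [W.IsElliptic] [W.IsGloballyMinimal] {p : ℕ} [Fact p.Prime]
  {P Q : IwasawaAlgebra p → IwasawaAlgebra p → Prop}

/-- Monotonicity of `InvariantsAt` in the relation. [folklore] -/
theorem InvariantsAt.mono (hPQ : ∀ g fE, P g fE → Q g fE) (h : InvariantsAt W p P) :
    InvariantsAt W p Q := by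
  intro κ γ hκ hγ hγ' N _ f hf D ϖ hϖ fE g hchar
  obtain ⟨h₁, h₂⟩ := h κ γ hκ hγ hγ' f hf D ϖ hϖ fE g hchar
  exact ⟨fun hns L hL hι => hPQ g fE (h₁ hns L hL hι),
    fun hs L hL hι => hPQ g fE (h₂ hs L hL hι)⟩

/-- Conjunction of two `InvariantsAt` statements. [folklore] -/
theorem InvariantsAt.and (hP : InvariantsAt W p P) (hQ : InvariantsAt W p Q) :
    InvariantsAt W p fun g fE => P g fE ∧ Q g fE := by
  intro κ γ hκ hγ hγ' N _ f hf D ϖ hϖ fE g hchar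
  obtain ⟨hP₁, hP₂⟩ := hP κ γ hκ hγ hγ' f hf D ϖ hϖ fE g hchar
  obtain ⟨hQ₁, hQ₂⟩ := hQ κ γ hκ hγ hγ' f hf D ϖ hϖ fE g hchar
  exact ⟨fun hns L hL hι => ⟨hP₁ hns L hL hι, hQ₁ hns L hL hι⟩,
    fun hs L hL hι => ⟨hP₂ hs L hL hι, hQ₂ hs L hL hι⟩⟩

variable (W p) in
/-- `X11a.InvariantsMatchAt` is `InvariantsAt` for the relation "`μ` and `λ` agree". [folklore] -/
theorem invariantsMatchAt_iff :
    InvariantsMatchAt W p ↔ InvariantsAt W p fun g fE => mu g = mu fE ∧ lam g = lam fE :=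
  Iff.rfl

variable (W p) in
/-- `MuPartAt ∧ LambdaPartAt` as one `InvariantsAt` statement. [folklore] -/
theorem muPart_and_lambdaPart_iff :
    MuPartAt W p ∧ LambdaPartAt W p ↔ InvariantsAt W p fun g fE => mu g ≤ mu fE ∧ lam g ≤ lam fE :=
  ⟨fun h => h.1.and h.2, fun h => ⟨h.mono fun _ _ h' => h'.1, h.mono fun _ _ h' => h'.2⟩⟩

/-- Equal invariants give the two parts (one direction of the split, unconditionally). [folklore] -/
theorem muPart_and_lambdaPart_of_invariantsMatchAt (h : InvariantsMatchAt W p) :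
    MuPartAt W p ∧ LambdaPartAt W p :=
  (muPart_and_lambdaPart_iff W p).mpr
    (InvariantsAt.mono (fun _ _ h' => ⟨h'.1.le, h'.2.le⟩) ((invariantsMatchAt_iff W p).mp h))

end Combinators

/-! ### Kato's factorisation and non-vanishing at the pairs -/

section Kato

variable (W : WeierstrassCurve ℚ) [W.IsElliptic] [W.IsGloballyMinimal] (p : ℕ) [Fact p.Prime]

/-- **Kato's divisibility at the pairs**: at a multiplicative `p ≥ 5` with `ρ̄_{E,p}` surjective
(hence every `ρ̄_{E,p^n}` surjective, Serre — tree theorem), `fE ∣ g` for every Kato pair: Kato gives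
SOME `g' ∈ char_Λ X = (fE)` with `ι(T^e g') = ϖ·L_p` (`hKato`), and `ι` is injective (`T` is not a
zero divisor), so `g = g'`. [cite: Wuthrich2014, Thm. 3 (p. 382) and Cor. 19 proof (p. 399)] -/
theorem invariantsAt_dvd_of_kato (hKato : kato_charIdeal_dvd_multiplicative_of_surjective)
    (hp : 5 ≤ p) (hmult : W.HasMultiplicativeReductionAtPrime p)
    (hsurj : W.HasSurjectiveModNGaloisRep p) :
    InvariantsAt W p fun g fE => fE ∣ g := by
  intro κ γ hκ hγ hγ' N _ f hf D ϖ hϖ fE g hchar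
  have hp2 : p ≠ 2 := by omega
  have hsurj' : ∀ n : ℕ, W.HasSurjectiveModNGaloisRep (p ^ n : ℕ) :=
    kato_charIdeal_dvd_multiplicative_of_surjective.surjective_pow_of_five_le W p hp hsurj
  obtain ⟨-, hKns, hKs⟩ := hKato W p hp2 hmult hsurj' hκ hγ hγ' hf D ϖ hϖ
  have hinj := iwasawaToPowerSeries_injective p
  refine ⟨fun hns L hL hι => ?_, fun hs L hL hι => ?_⟩
  · obtain ⟨g', hg'mem, hι'⟩ := hKns hns L hL
    have hgg' : g = g' := hinj (hι.trans hι'.symm)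
    rw [hgg']
    rw [hchar] at hg'mem
    exact Ideal.mem_span_singleton.mp hg'mem
  · obtain ⟨g', hg'mem, hι'⟩ := hKs hs L hL
    have hXg : (PowerSeries.X : IwasawaAlgebra p) * g = PowerSeries.X * g' := hinj (hι.trans hι'.symm)
    have hgg' : g = g' := mul_left_cancel₀ PowerSeries.X_ne_zero hXg
    rw [hgg']
    rw [hchar] at hg'mem
    exact Ideal.mem_span_singleton.mp hg'mem

/-- **Non-vanishing at the pairs in analytic rank `0`**: `g ≠ 0` for every Kato pair, because
`g(0) = ϖ·L_p(0) = ϖ·2[0]⁺_f ≠ 0` (non-split; Mazur–Tate–Teitelbaum, `α = -1`), resp.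
`g(0) = ϖ·[T¹]L_p` with `[T¹]L_p · log κ(γ) = 𝓛_p·[0]⁺_f ≠ 0` (split; Greenberg–Stevens `hGS` and
`𝓛_p ≠ 0`, tree theorem), `[0]⁺_f ≠ 0` by `r_an = 0` (modularity `hmod`), `ϖ ≠ 0` since `Ω⁺_f > 0`.
(Extracted from gen 13's `mazurMainConjectureAt_of_invariantsMatchAt`.)
[cite: MazurTateTeitelbaum1986, §I.14–15] [cite: GreenbergStevens1993, Thm. (p-adic BSD, split case)] -/
theorem invariantsAt_ne_zero (hmod : hasEntireLFunction_rat)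
    (hGS : greenberg_stevens (W := W) (p := p)) (hr : W.analyticRank = 0) :
    InvariantsAt W p fun g _ => g ≠ 0 := by
  intro κ γ hκ hγ hγ' N _ f hf D ϖ hϖ fE g hchar
  have hL1 : W.entireLFunction 1 ≠ 0 := (W.analyticRank_eq_zero_iff_holds (hmod W)).1 hr
  have hϖ0 : ϖ ≠ 0 := by
    rintro rfl
    have hper : 0 < plusPeriod f := IsNewform0.plusPeriod_pos_holds hf.1 hf.coeffField_eq_bot
    rw [← hϖ, Rat.cast_zero, zero_mul] at hper
    exact lt_irrefl _ hper
  set s : ℚ := ratPlusSymbol f 0 with hs_def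
  have hLval : W.entireLFunction 1 = (((s : ℝ) * plusPeriod f : ℝ) : ℂ) := hf.entireLFunction_one_eq
  have hs0 : s ≠ 0 := by
    intro h0
    apply hL1
    rw [hLval, h0]
    simp
  have hsQ0 : (s : ℚ_[p]) ≠ 0 := by exact_mod_cast hs0
  have hϖQ0 : ((ϖ : ℚ) : ℚ_[p]) ≠ 0 := by exact_mod_cast hϖ0
  refine ⟨fun hns L hL hιg => ?_, fun hsplit L hL hιg => ?_⟩
  · -- non-split: `g(0) = ϖ·2[0]⁺_f ≠ 0`
    have hL0 : PowerSeries.constantCoeff L = 2 * (s : ℚ_[p]) := hL.constantCoeff_of_neg_one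
    have h1 : ((PowerSeries.constantCoeff g : ℤ_[p]) : ℚ_[p]) =
        ((ϖ : ℚ) : ℚ_[p]) * (2 * (s : ℚ_[p])) := by
      have h := congrArg PowerSeries.constantCoeff hιg
      rw [constantCoeff_iwasawaToPowerSeries, map_mul, PowerSeries.constantCoeff_C, hL0] at h
      exact h
    intro h0
    have : ((PowerSeries.constantCoeff g : ℤ_[p]) : ℚ_[p]) = 0 := by
      rw [h0, map_zero, PadicInt.coe_zero]
    rw [h1] at this
    exact (mul_ne_zero hϖQ0 (mul_ne_zero two_ne_zero hsQ0)) this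
  · -- split: `g(0) = ϖ·[T¹]L_p ≠ 0`
    obtain ⟨Dq⟩ := (nonempty_tateParameterData_iff_holds (W := W) (p := p)).mpr hsplit
    obtain ⟨-, hGS1⟩ := hGS Dq hf hL
    have h𝓛0 : LInvariant Dq ≠ 0 := LInvariant_ne_zero_holds Dq
    have hc1 : PowerSeries.coeff 1 L ≠ 0 := by
      intro h0
      rw [h0, zero_mul] at hGS1
      exact (mul_ne_zero h𝓛0 hsQ0) hGS1.symm
    have h1 : ((PowerSeries.constantCoeff g : ℤ_[p]) : ℚ_[p]) =
        ((ϖ : ℚ) : ℚ_[p]) * PowerSeries.coeff 1 L := by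
      have h := congrArg (PowerSeries.coeff 1) hιg
      rw [iwasawaToPowerSeries, PowerSeries.coeff_map, PowerSeries.coeff_succ_X_mul,
        PowerSeries.coeff_zero_eq_constantCoeff, PowerSeries.coeff_C_mul] at h
      exact h
    intro h0
    have : ((PowerSeries.constantCoeff g : ℤ_[p]) : ℚ_[p]) = 0 := by
      rw [h0, map_zero, PadicInt.coe_zero]
    rw [h1] at this
    exact (mul_ne_zero hϖQ0 hc1) this

end Kato

/-! ### The certificate: `μ^an(E,p) = 0`, hence `μ^alg(E,p) = 0` -/

section Certificate

variable (W : WeierstrassCurve ℚ) [W.IsElliptic] [W.IsGloballyMinimal] (p : ℕ) [Fact p.Prime]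

/-- **The certificate in `Λ`-terms**: `MuAnZeroAt W p` gives unit content (`μ = 0`) of every `g ∈ Λ`
with `ι(T^e g) = ϖ·L_p` — unconditionally (`ι` is coefficientwise `ℤ_p ↪ ℚ_p`; the shift by `T`
does not change the content). [cite: GreenbergVatsal2000, p. 2, (2)]
[cite: EmertonPollackWeston2006, Def. 4.4.1 and the remark after Lemma 4.4.3] -/
theorem invariantsAt_hasUnitContent_of_muAnZeroAt (hμ : MuAnZeroAt W p) :
    InvariantsAt W p fun g _ => HasUnitContent g := by
  intro κ γ hκ hγ hγ' N _ f hf D ϖ hϖ fE g hchar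
  refine ⟨fun hns L hL hι => ?_, fun hs L hL hι => ?_⟩
  · obtain ⟨n, hn⟩ := (hμ f hf ϖ hϖ).1 hns L hL
    rw [← hι] at hn
    exact (hasUnitContent_iff_exists_norm_coeff_map_eq_one g).mpr ⟨n, hn⟩
  · obtain ⟨n, hn⟩ := (hμ f hf ϖ hϖ).2 hs L hL
    rw [← hι] at hn
    exact (hasUnitContent_X_mul_iff g).mp
      ((hasUnitContent_iff_exists_norm_coeff_map_eq_one _).mpr ⟨n, hn⟩)

/-- **The certificate gives the μ-part** (`μ(g) = 0 ≤ μ(fE)`), at any pair, no hypothesis.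
[cite: GreenbergVatsal2000, p. 2–4] -/
theorem muPartAt_of_muAnZeroAt (hμ : MuAnZeroAt W p) : MuPartAt W p :=
  (invariantsAt_hasUnitContent_of_muAnZeroAt W p hμ).mono fun _ _ h =>
    (mu_eq_zero_of_hasUnitContent h).le.trans (Nat.zero_le _)

/-- **`μ^alg(E,p) = 0` from the certificate and Kato's divisibility** (step [L4] of the audited
chain HOME/b2b-bsdres-x11a/X11A-CHAIN.md): at a multiplicative `p ≥ 5` with `ρ̄_{E,p}` surjective,
`MuAnZeroAt W p` forces every generator `fE` of `char_Λ X(E/ℚ_∞)` paired with a Kato element to have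
unit content — `g = h·fE` (Kato, `hKato`) and `p ∤ g` give `p ∤ fE` — i.e. `μ(X(E/ℚ_∞)) = 0`
(Greenberg–Vatsal (1)–(2); `GreenbergVatsal2000.mu_eq_zero_iff_hasUnitContent`). The inequality
`μ^alg ≤ μ^an` is Kato's; the certificate makes both vanish. [cite: Wuthrich2014, Thm. 3 (p. 382) and Cor. 19 proof (p. 399)]
[cite: GreenbergVatsal2000, p. 2–4, (1)–(2)] [cite: EmertonPollackWeston2006, Thm. 5.1.2] -/
theorem invariantsAt_hasUnitContent_generator_of_muAnZeroAt
    (hKato : kato_charIdeal_dvd_multiplicative_of_surjective)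
    (hp : 5 ≤ p) (hmult : W.HasMultiplicativeReductionAtPrime p)
    (hsurj : W.HasSurjectiveModNGaloisRep p) (hμ : MuAnZeroAt W p) :
    InvariantsAt W p fun g fE => HasUnitContent g ∧ HasUnitContent fE ∧ mu g = 0 ∧ mu fE = 0 :=
  ((invariantsAt_hasUnitContent_of_muAnZeroAt W p hμ).and
    (invariantsAt_dvd_of_kato W p hKato hp hmult hsurj)).mono fun g fE h => by
      obtain ⟨hg, ⟨c, hc⟩⟩ := h
      have hfE : HasUnitContent fE := hasUnitContent_left_of_mul (a := fE) (b := c) (hc ▸ hg)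
      exact ⟨hg, hfE, mu_eq_zero_of_hasUnitContent hg, mu_eq_zero_of_hasUnitContent hfE⟩

end Certificate

end Summit.BirchSwinnertonDyer.Rank1Residual.X11a

end
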